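/-
Copyright (c) 2026. All rights reserved.
Released under Apache 2.0 license as described in the file LICENSE.
Authors: abc-iut cell — statements drafted by seat abc-iut-L4-t2 (wave 1); adopted, revised and filed by
seat abc-iut-L4-t14 (wave 2, block W2-B16, L4 ruling ρ handover: announced names kept).
-/
import Literature.AnabelianGeometry.AbsoluteAnabelian.HolomorphicCores
import Literature.AnabelianGeometry.AbsoluteAnabelian.FundamentalExtension
import Mathlib.Analysis.Normed.Algebra.Exponential
import HarnessLib

/-!
# Archimedean log-Frobenius compatibility, I: CAF data, Kummer structures, (model) Aut-holomorphic
# `T`-pairs and their morphisms ([AbsTopIII] §4: Def 4.1 (i), (ii); around Prop 4.2 (i); Rmk 4.2.1)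

Statements-first typing (D-0014) of S. Mochizuki, *Topics in absolute anabelian geometry III*, §4
(bib key `MochizukiAbsTopIII2015`; locators = kurims manuscript pages, lit key
`paper:url-5493eb38cbb7`).

* Def 4.1 (i) p.101 — a CAF `k`: a normed field satisfying the tree's `IsCAF` of
  `FundamentalExtension.lean` ([AbsTopIII] §0: topological field isomorphic to `ℂ`; every field norm
  inducing that topology is a power of the usual absolute value, so "absolute value `≤ 1` / `= 1`" is
  intrinsic),
  `𝒪_k` (closed unit disc), `𝒪_k^×` (unit circle), `𝒪_k^⊳`, the universal covering `k~ ↠ k^×`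
  realised as `exp : (k,+) → k^×` so that `log_k : k~ ⥲ k` is the identity of `k` (REAL
  definitions), the field `𝒜_𝕏 = 𝒜_p ∪ {0}` of an elliptically admissible Aut-holomorphic orbispace
  as an INTERFACE `LinHolField` over `LocalLinearHolStructure` (Cor 2.7 (e)), `k`-Kummer
  structures `κ_k : k ⥲ 𝒜_𝕏`, the types `T ∈ {TF, TCG, TLG, TM, TH, TH⊞}` and model Aut-holomorphic
  `T`-pairs `(𝕏 ↶ M_k)` for the four algebraic types;
* Def 4.1 (ii) p.102 — Aut-holomorphic `T`-pairs (isomorphic to a model), structure-orbispace,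
  arithmetic data, morphisms (`φ_M` + compatible finite étale `φ_𝕏`), `T`-isomorphisms and
  structure-isomorphisms;
* Prop 4.2 (i) p.105 ("the natural functor induces a bijection
  `Isom_{𝒞^hol_T}((𝕏 ↶ M),(𝕏* ↶ M*)) ⥲ Isom_EA(𝕏, 𝕏*)`; in particular `EA`, `𝒞^hol_T`, `𝒞^{hol-sB}_T` are
  id-rigid") — NOT TYPED HERE: it quantifies over the `𝒜`-isomorphism INDUCED by `φ_𝕏` via the
  functoriality of Cor 2.7 (e), which the tree does not construct (the interface `LocalLinearHolStructure`
  of `HolomorphicCores.lean` has no functoriality datum); typed instead is the formal core of its printed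
  proof: Kummer structures of Aut-holomorphic pairs are injective (`IsAutHolPair.κM_injective`) and
  `φ_M` is determined by the `𝒜`-part (`AutHolPair.Iso.isoM_eq_of_isoA_eq`) — abc-iut-L6-t11's lemmas,
  PROVED; Rmk 4.2.1 p.106 ("the id-rigidity portion … is false for the `𝒞̲` and `𝒞̲̲` versions", "as is
  easily verified", no argument printed) — RECORDED (needs the categories).
The sibling file `ArchimedeanLogFrobeniusFunctors.lean` carries Def 4.1 (iii) (the natural functors,
object level), Def 4.1 (iv) (the log-Frobenius operation `𝔩𝔬𝔤_{TF,TF}`, the pre-log-shell), Def 4.1 (v)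
(`LinHol`), Prop 4.2 (ii), Lemma 4.3, Lemma 4.4 and the records of Rmk 4.1.1, 4.1.2.

HANDOVER (L4 ruling ρ, 2026-08-25): this file is abc-iut-L4-t2's staged draft, adopted by
abc-iut-L4-t14 with every announced declaration NAME kept; changes made on adoption: (1) the
structure-orbispace of a (model) Aut-holomorphic pair is carried by the `AutHolOrbiPresentation` itself
(`AutHolPair.U := P.X.U`, one topology) instead of a separate type with a type-equality field;
(2) `AutHolPair.Iso` / `AutHolPair.Hom` now REQUIRE the structure-(iso)morphism to be an
(iso)morphism of the Aut-holomorphic structures of the presenting spaces (audit note A21-N1); the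
field isomorphism `isoA` / `homA` remains free data standing for the isomorphism of the `𝒜_𝕏`
INDUCED by functoriality of Cor 2.7 (not constructed here) — which is why Prop 4.2 (i) is not typed
(review of p407670: a version relative to a free `isoA` is weaker than print and must not carry its
name); (3) the universal covering of the log-Frobenius output is a definition, not a default-valued field
(audit A21-F2; in the sibling file).

Deliberately NOT here: the types `TH`, `TH⊞` beyond their index, Cor 4.5 and Rmk 4.5.1–4.5.3 (seat
abc-iut-L4-t10, `FrobeniusPictureNF` / `ArchLogFrobeniusRemarks`).  Refereed pre-IUT anabelian
geometry; nothing here bears on the disputed [IUTchIII] Cor. 3.12; named facts are quoted, not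
asserted; typed ≠ discharged.
-/

namespace Literature.AnabelianGeometry.AbsoluteAnabelian

open _root_.TopologicalSpace _root_.Topology
open scoped _root_.Manifold _root_.ContDiff

universe u

noncomputable section

/-! ### Definition 4.1 (i): CAF data -/

section CAF

variable (k : Type u) [NormedField k]

/-- `𝒪_k ⊆ k`: "the subset of elements of absolute value `≤ 1`".
[cite: MochizukiAbsTopIII2015, Definition 4.1 (i) p.101] -/
def archIntegers : Set k := {x | ‖x‖ ≤ 1}

/-- `𝒪_k^× ⊆ 𝒪_k`: "the subgroup of units [i.e., elements of absolute value equal to `1`]", as a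
subgroup of `k^×`.
[cite: MochizukiAbsTopIII2015, Definition 4.1 (i) p.101] -/
def archUnits : Subgroup kˣ where
  carrier := {x | ‖(x : k)‖ = 1}
  one_mem' := by simp
  mul_mem' {x y} hx hy := by
    simp only [Set.mem_setOf_eq, Units.val_mul, norm_mul] at *
    rw [hx, hy, one_mul]
  inv_mem' {x} hx := by
    simp only [Set.mem_setOf_eq, Units.val_inv_eq_inv_val, norm_inv] at *
    rw [hx, inv_one]

/-- `𝒪_k^⊳ ⊆ 𝒪_k`: "the multiplicative monoid of nonzero elements" of `𝒪_k`, as a submonoid of `k^×`.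
[cite: MochizukiAbsTopIII2015, Definition 4.1 (i) p.101] -/
def archNonzeroIntegers : Submonoid kˣ where
  carrier := {x | ‖(x : k)‖ ≤ 1}
  one_mem' := by simp
  mul_mem' {x y} hx hy := by
    simp only [Set.mem_setOf_eq, Units.val_mul, norm_mul] at *
    exact mul_le_one₀ hx (norm_nonneg _) hy

/-- **The universal covering `k~ ↠ k^×`** of Def 4.1 (i): "uniquely determined, up to unique
isomorphism, as a pointed topological space … the pointed topological space `k~` admits a natural
topological group structure … the 'inverse' of the exponential map `k → k^×` determines an
isomorphism of topological groups `log_k : k~ ⥲ k`".  We REALISE `k~` as the additive group `(k,+)`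
itself (so `log_k` is the identity) and the covering map as the exponential `k → k^×`
(Mathlib `NormedSpace.exp`, the `ℚ`-exponential series; for `k ≅ ℂ` this is `Complex.exp`).
[cite: MochizukiAbsTopIII2015, Definition 4.1 (i) p.101] -/
def univCover [CharZero k] (x : k) : k := NormedSpace.exp x

end CAF

/-! ### Definition 4.1 (i): the field `𝒜_𝕏` and Kummer structures -/

/-- **Def 4.1 (i): the topological field `𝒜_𝕏_ell := 𝒜_𝕏_ell ∪ {0}`** of an elliptically admissible
Aut-holomorphic orbispace — "the `𝒜_p` of Corollary 2.7, (e) [equipped with various topological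
and algebraic structures], which may be identified [hence considered as an object that is
independent of `p`] via the various isomorphisms `𝒜_p ⥲ 𝒜_{p'}`".  INTERFACE over a
`LocalLinearHolStructure`: a normed field `F` with, for every `p`, an isomorphism of topological
groups `F^× ⥲ 𝒜_p` compatible with the transition isomorphisms.
[cite: MochizukiAbsTopIII2015, Definition 4.1 (i) p.101] -/
structure LinHolField {U : Type u} (L : LocalLinearHolStructure U) : Type (u + 1) where
  /-- The field `𝒜_𝕏 ∪ {0}`. -/
  F : Type u
  [normedField : NormedField F]
  /-- `F^× ⥲ 𝒜_p`. -/
  unitsIso : ∀ p : U, Fˣ ≃ₜ* L.A p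
  unitsIso_trans : ∀ p p' : U, (unitsIso p).trans (L.trans p p') = unitsIso p'

attribute [instance] LinHolField.normedField

/-- **Def 4.1 (i): a `k`-Kummer structure** on `𝕏_ell`: "any isomorphism of topological fields
`κ_k : k ⥲ 𝒜_𝕏_ell`" — a ring isomorphism that is a homeomorphism.
[cite: MochizukiAbsTopIII2015, Definition 4.1 (i) p.101] -/
structure KummerStructure (k : Type u) [NormedField k] {U : Type u} {L : LocalLinearHolStructure U}
    (A : LinHolField L) : Type u where
  /-- `κ_k`. -/
  κ : k ≃+* A.F
  continuous_κ : Continuous κ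
  continuous_κ_symm : Continuous κ.symm

/-- The six types `T ∈ {TF, TCG, TLG, TM, TH, TH⊞}` of arithmetic data of Def 4.1 (i): topological
fields; compact / locally compact abelian groups; monoids; "the category of connected
Aut-holomorphic orbispaces"; "the category of connected Aut-holomorphic groups [i.e.,
Aut-holomorphic spaces equipped with a topological group structure such that both … structures
arise from a single connected complex Lie group structure]".
[cite: MochizukiAbsTopIII2015, Definition 4.1 (i) pp.101–102] -/
inductive ArchPairType
  | TF | TCG | TLG | TM | TH | THadd
  deriving DecidableEq

/-- The ALGEBRAIC types `TF, TCG, TLG, TM` — those for which a model object `M_k ⊆ k` exists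
(Def 4.1 (i): `M_k = k`, `𝒪_k^×`, `k^×`, `𝒪_k^⊳`); `TH`, `TH⊞` have no model arithmetic datum inside `k`.
[cite: MochizukiAbsTopIII2015, Definition 4.1 (i) p.102] -/
def ArchPairType.IsAlgebraic (T : ArchPairType) : Prop := T ≠ .TH ∧ T ≠ .THadd

/-- **Def 4.1 (i): model Aut-holomorphic `T`-pair** `(𝕏_ell ↶^κ M_k)` for the algebraic types: (a)
the elliptically admissible Aut-holomorphic orbispace (as `U` with its local linear holomorphic
structure and field `𝒜_𝕏`), (b) the object `M_k` — `k` (`TF`), `𝒪_k^×` (`TCG`), `k^×` (`TLG`),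
`𝒪_k^⊳` (`TM`) — recorded through `k` and the type index, (c) "the datum `κ_{M_k} : M_k → 𝒜_𝕏_ell`", the
restriction of a `k`-Kummer structure `κ_k` to `M_k ⊆ k`.
[cite: MochizukiAbsTopIII2015, Definition 4.1 (i) p.102] -/
structure ModelAutHolPair (T : ArchPairType) : Type (u + 1) where
  /-- The CAF `k`. -/
  k : Type u
  [normedField : NormedField k]
  isCAF : IsCAF k
  /-- The structure-orbispace `𝕏_ell`, a presentation `[U/Γ]` (Rmk 2.1.1); its presenting space
  `X.U` carries the one topology used throughout. -/
  X : AutHolOrbiPresentation.{u}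
  /-- Its local linear holomorphic structure (Cor 2.7 (e)) and field `𝒜_𝕏`. -/
  L : LocalLinearHolStructure X.U
  A : LinHolField L
  /-- The Kummer structure `κ_k`. -/
  κ : KummerStructure k A
  /-- the type is one of the four algebraic ones -/
  algebraic : T.IsAlgebraic

attribute [instance] ModelAutHolPair.normedField

/-- The presenting topological space `U` of the structure-orbispace `𝕏_ell = [U/Γ]` of a model pair.
[cite: MochizukiAbsTopIII2015, Definition 4.1 (i) p.102] -/
abbrev ModelAutHolPair.U {T : ArchPairType} (P : ModelAutHolPair.{u} T) : Type u := P.X.U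

/-- The arithmetic data `M_k ⊆ k` of a model pair, by type: `k`, `𝒪_k^×`, `k^×`, `𝒪_k^⊳` (as subsets
of `k`; empty for the non-algebraic types, which have no model object).
[cite: MochizukiAbsTopIII2015, Definition 4.1 (i) p.102] -/
def ModelAutHolPair.arithData {T : ArchPairType} (P : ModelAutHolPair.{u} T) : Set P.k :=
  match T with
  | .TF => Set.univ
  | .TCG => {x | ‖x‖ = 1}
  | .TLG => {x | x ≠ 0}
  | .TM => {x | x ≠ 0 ∧ ‖x‖ ≤ 1}
  | .TH => ∅
  | .THadd => ∅

/-- `κ_{M_k} : M_k → 𝒜_𝕏_ell`, "the restriction of `κ_k` to `M_k ⊆ k`".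
[cite: MochizukiAbsTopIII2015, Definition 4.1 (i) p.102] -/
def ModelAutHolPair.κM {T : ArchPairType} (P : ModelAutHolPair.{u} T) : P.arithData → P.A.F :=
  fun x => P.κ.κ x.1

/-! ### Definition 4.1 (ii): Aut-holomorphic `T`-pairs and their morphisms -/

/-- **Def 4.1 (ii): an Aut-holomorphic `T`-pair** `(𝕏 ↶^κ M)` for the algebraic types: an
elliptically admissible Aut-holomorphic orbispace `𝕏` (with `𝒜_𝕏`), an object `M` (a monoid with a
topology; a field for `TF`), and "a datum `κ_M : M → 𝒜_𝕏`, the Kummer structure", subject to (a)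
`κ_M` continuous and (c) being isomorphic to a model pair compatibly with the Kummer structures.
Typed with `M` a topological monoid mapping to `𝒜_𝕏` multiplicatively.
[cite: MochizukiAbsTopIII2015, Definition 4.1 (ii) p.102] -/
structure AutHolPair : Type (u + 1) where
  /-- The structure-orbispace `𝕏` (a presentation `[U/Γ]`, Rmk 2.1.1). -/
  X : AutHolOrbiPresentation.{u}
  /-- Local linear holomorphic structure and `𝒜_𝕏` on the presenting space. -/
  L : LocalLinearHolStructure X.U
  A : LinHolField L
  /-- The arithmetic data `M`. -/
  M : Type u
  [monoid : CommMonoid M]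
  [topM : TopologicalSpace M]
  /-- The Kummer structure `κ_M : M → 𝒜_𝕏`. -/
  κM : M →* A.F
  continuous_κM : Continuous κM

attribute [instance] AutHolPair.monoid AutHolPair.topM

/-- The presenting topological space of the structure-orbispace `𝕏 = [U/Γ]` of an Aut-holomorphic pair.
[cite: MochizukiAbsTopIII2015, Definition 4.1 (ii) p.102] -/
abbrev AutHolPair.U (P : AutHolPair.{u}) : Type u := P.X.U

/-- The Aut-holomorphic `T`-pair underlying a model pair (for `T ≠ TF` the arithmetic data is the
submonoid `M_k` of `k`; for `TF` it is `k` minus nothing but viewed multiplicatively on `k` — we use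
the multiplicative monoid of the subset in all cases).
[cite: MochizukiAbsTopIII2015, Definition 4.1 (ii) p.102] -/
def ModelAutHolPair.toPair {T : ArchPairType} (P : ModelAutHolPair.{u} T)
    (hmul : ∀ x y : P.k, x ∈ P.arithData → y ∈ P.arithData → x * y ∈ P.arithData)
    (hone : (1 : P.k) ∈ P.arithData) : AutHolPair.{u} where
  X := P.X
  L := P.L
  A := P.A
  M := ({ carrier := P.arithData, mul_mem' := fun hx hy => hmul _ _ hx hy, one_mem' := hone } :
    Submonoid P.k)
  κM := (P.κ.κ : P.k →+* P.A.F).toMonoidHom.comp (Submonoid.subtype _)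
  continuous_κM := P.κ.continuous_κ.comp continuous_subtype_val

/-- An **isomorphism of Aut-holomorphic `T`-pairs**: an isomorphism of structure-orbispaces — here, at
the level of the chosen PRESENTATIONS `[U/Γ]` (Rmk 2.1.1 as typed in `Coorientations.lean`): a
homeomorphism of presenting spaces that is an isomorphism of their Aut-holomorphic structures in both
directions — together with an isomorphism of arithmetic data, compatible with the Kummer structures
through an isomorphism of the fields `𝒜_𝕏`.  (Two presentations of the same orbispace are not
identified by this typing; a model pair may always be chosen with the given presentation, so
`IsAutHolPair` below is unaffected.)
[cite: MochizukiAbsTopIII2015, Definition 4.1 (ii) p.102] -/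
structure AutHolPair.Iso (P Q : AutHolPair.{u}) : Type u where
  /-- The structure-isomorphism on presenting spaces. -/
  isoU : P.U ≃ₜ Q.U
  /-- … which is an isomorphism of the Aut-holomorphic structures of the presenting spaces (an
  isomorphism "of objects of `TH`" at the level of the presentations; A21-N1). -/
  isoU_isMorphism : IsMorphism P.X.str Q.X.str isoU ∧ IsMorphism Q.X.str P.X.str isoU.symm
  /-- The isomorphism `𝒜_𝕏 ⥲ 𝒜_𝕐` standing for the one INDUCED by `isoU` (functoriality of Cor 2.7;
  free data here — the inducing algorithm is not constructed in this file). -/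
  isoA : P.A.F ≃+* Q.A.F
  /-- The isomorphism of arithmetic data. -/
  isoM : P.M ≃* Q.M
  continuous_isoM : Continuous isoM ∧ Continuous isoM.symm
  kummer_compat : ∀ m : P.M, Q.κM (isoM m) = isoA (P.κM m)

/-- **Def 4.1 (ii)**: `(𝕏 ↶^κ M)` **is an Aut-holomorphic `T`-pair**: isomorphic to (the pair underlying)
some model Aut-holomorphic `T`-pair.
[cite: MochizukiAbsTopIII2015, Definition 4.1 (ii) p.102] -/
@[mk_iff]
structure IsAutHolPair (T : ArchPairType) (P : AutHolPair.{u}) : Prop where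
  exists_model : ∃ (Q : ModelAutHolPair.{u} T) (hmul : _) (hone : _),
    Nonempty (AutHolPair.Iso (Q.toPair hmul hone) P)

/-- **Def 4.1 (ii): a morphism of Aut-holomorphic `T`-pairs** `φ : (𝕏₁ ↶ M₁) → (𝕏₂ ↶ M₂)`: "a morphism
of objects `φ_M : M₁ → M₂` of `T`, together with a compatible [relative to the respective Kummer
structures] finite étale morphism `φ_𝕏 : 𝕏₁ → 𝕏₂`"; a **`T`-isomorphism** if `φ_M` is an
isomorphism, a **structure-isomorphism** if `φ_𝕏` is.
[cite: MochizukiAbsTopIII2015, Definition 4.1 (ii) p.102] -/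
structure AutHolPair.Hom (P Q : AutHolPair.{u}) : Type u where
  /-- `φ_𝕏` on presenting spaces. -/
  homU : P.U → Q.U
  /-- `φ_𝕏` is a morphism of the Aut-holomorphic structures of the presenting spaces … -/
  isMorphism : IsMorphism P.X.str Q.X.str homU
  /-- … and finite étale. -/
  finiteEtale : IsFiniteEtale homU
  /-- The homomorphism `𝒜_𝕏₁ → 𝒜_𝕏₂` standing for the one induced by `φ_𝕏` (functoriality of Cor 2.7
  in finite étale morphisms; free data here). -/
  homA : P.A.F →+* Q.A.F
  /-- `φ_M`. -/
  homM : P.M →* Q.M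
  continuous_homM : Continuous homM
  kummer_compat : ∀ m : P.M, Q.κM (homM m) = homA (P.κM m)

/-- `T`-isomorphism: `φ_M` is an isomorphism.
[cite: MochizukiAbsTopIII2015, Definition 4.1 (ii) p.102] -/
def AutHolPair.Hom.IsTIso {P Q : AutHolPair.{u}} (φ : P.Hom Q) : Prop :=
  Function.Bijective φ.homM ∧ IsOpenMap φ.homM

/-- Structure-isomorphism: `φ_𝕏` is an isomorphism (a homeomorphism).
[cite: MochizukiAbsTopIII2015, Definition 4.1 (ii) p.102] -/
def AutHolPair.Hom.IsStructureIso {P Q : AutHolPair.{u}} (φ : P.Hom Q) : Prop :=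
  Function.Bijective φ.homU ∧ IsOpenMap φ.homU

/-! ### Around Proposition 4.2 (i): what the definitions already give (Prop 4.2 (i) itself is NOT typed) -/

/-! Prop 4.2 (i) p.105 ("the natural functor of Def 4.1 (iii) induces a BIJECTION
`Isom_{𝒞^hol_T}((𝕏 ↶ M),(𝕏* ↶ M*)) ⥲ Isom_EA(𝕏, 𝕏*)` … in particular `EA`, `𝒞^hol_T`, `𝒞^{hol-sB}_T` are
id-rigid") is NOT TYPED in this file: both halves and the id-rigidity refer to the isomorphism
`𝒜_𝕏 ⥲ 𝒜_𝕏*` INDUCED by a structure-isomorphism through the functoriality of Cor 2.7 (e), an algorithm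
that neither `HolomorphicCores.lean` (interface `LocalLinearHolStructure`) nor this file constructs; here
`AutHolPair.Iso.isoA` is free data standing for it.  What the definitions DO give — and what the printed
proof of Prop 4.2 (i) uses ("immediate from the required compatibility of morphisms of `𝒞^hol_T` with
the Kummer structures") — is proved below: Kummer structures of Aut-holomorphic pairs are injective,
hence the arithmetic part `φ_M` of an isomorphism is determined by its `𝒜`-part (abc-iut-L6-t11's
argument, 2026-08-25, included with its lemma names).  Rmk 4.2.1 p.106 (id-rigidity fails for the
`T`-iso / structure-iso subcategories) is recorded in the module docstring. -/

/-- The Kummer structure `κ_{M_k} : M_k → 𝒜_𝕏` of (the pair underlying) a MODEL Aut-holomorphic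
`T`-pair is injective: it is the restriction of the field isomorphism `κ_k` to `M_k ⊆ k`.
[cite: MochizukiAbsTopIII2015, Definition 4.1 (i) p.102] -/
theorem ModelAutHolPair.toPair_κM_injective {T : ArchPairType} (P : ModelAutHolPair T)
    (hmul : ∀ x y : P.k, x ∈ P.arithData → y ∈ P.arithData → x * y ∈ P.arithData)
    (hone : (1 : P.k) ∈ P.arithData) :
    Function.Injective (P.toPair hmul hone).κM := by
  intro x y h
  apply Subtype.val_injective
  apply P.κ.κ.injective
  exact h

/-- Injectivity of the Kummer structure is transported along isomorphisms of Aut-holomorphic pairs.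
[cite: MochizukiAbsTopIII2015, Definition 4.1 (ii) p.102] -/
theorem AutHolPair.Iso.κM_injective {P Q : AutHolPair} (e : P.Iso Q)
    (hP : Function.Injective P.κM) : Function.Injective Q.κM := by
  intro a b hab
  obtain ⟨a', rfl⟩ := e.isoM.surjective a
  obtain ⟨b', rfl⟩ := e.isoM.surjective b
  rw [e.kummer_compat, e.kummer_compat] at hab
  rw [hP (e.isoA.injective hab)]

/-- The Kummer structure `κ_M : M → 𝒜_𝕏` of an Aut-holomorphic `T`-pair is injective (Def 4.1 (ii):
such a pair is isomorphic to a model pair, whose Kummer structure is a restricted field isomorphism).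
[cite: MochizukiAbsTopIII2015, Definition 4.1 (ii) p.102] -/
theorem IsAutHolPair.κM_injective {T : ArchPairType} {P : AutHolPair} (hP : IsAutHolPair T P) :
    Function.Injective P.κM := by
  obtain ⟨Q, hmul, hone, ⟨e⟩⟩ := hP.exists_model
  exact e.κM_injective (Q.toPair_κM_injective hmul hone)

/-- The arithmetic part of an isomorphism of Aut-holomorphic `T`-pairs is DETERMINED BY ITS `𝒜`-PART:
two isomorphisms `(𝕏 ↶ M) ⥲ (𝕏* ↶ M*)` with the same field isomorphism `𝒜_𝕏 ⥲ 𝒜_𝕏*` have the same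
`φ_M` — because the Kummer structure of an Aut-holomorphic pair is injective and morphisms are
compatible with the Kummer structures (Def 4.1 (ii)).  This is the formal core of the printed proof of
Prop 4.2 (i), NOT Prop 4.2 (i) itself (which quantifies over the `𝒜`-isomorphism INDUCED by `φ_𝕏`;
see the note above). [cite: MochizukiAbsTopIII2015, Definition 4.1 (ii) p.102] -/
theorem AutHolPair.Iso.isoM_eq_of_isoA_eq {T : ArchPairType} {P Q : AutHolPair.{u}}
    (hQ : IsAutHolPair T Q) (e₁ e₂ : P.Iso Q) (hA : e₁.isoA = e₂.isoA) : e₁.isoM = e₂.isoM := by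
  have hinj := hQ.κM_injective
  apply MulEquiv.ext
  intro m
  apply hinj
  rw [e₁.kummer_compat, e₂.kummer_compat, hA]

end

end Literature.AnabelianGeometry.AbsoluteAnabelian
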